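import Mathlib
import HarnessLib
import Summits.HubbardSuperconductivity.HubbardSuperconductivity.Theorems.KLProgrammeC4aCoMovingBridge
import Summits.HubbardSuperconductivity.HubbardSuperconductivity.Theorems.KLProgrammeC4aRigidConfigurations
import Summits.HubbardSuperconductivity.HubbardSuperconductivity.Theorems.KLProgrammeC4aLevelChart
import Summits.HubbardSuperconductivity.HubbardSuperconductivity.Theorems.KLProgrammeKLRegimeEngineFrameLevelCount

/-!
# Route `KLProgramme` — crux C4a, S3 brick (B1): THE PARTNER BAND OF THE CO-MOVING BUBBLE LOOP IS CRITICAL AT BOTH SINGULAR CONFIGURATIONS —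
# exact nesting at Cooper / forward, value and first-order criticality at the tangency configurations

Cell `gate-hubbard-kl`, lane hubbard-kl-c4a-1 (g6); helper for stub (C) `stub_twoLeg_curvature` of the engine-flow child `KLRegimeEngineV17F2`
(stmt-HubbardSuperconductivity-20437); memo HOME/hubbard-kl-c4a-1/C4A-PLAN.md §10, §24.4.  In the co-moving reading of the second-order vertex the pp bubble is read at
`S(t) = Φ(0,θ+t) + Φ(ρ,ϑ+θ+t)` (`pairSumPath`), the ph-crossed bubble at `D(t) = Φ(0,θ+t) − Φ(ρ,ϑ+θ+t)` (`pairDiffPath`).  Rotating the LOOP momentum with the flow,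
`p = Φ(e, φ+θ+t)`, the propagator `G(p)` sees only the level `e` (t-free) and ALL t-dependence sits in the PARTNER BAND `ē(t) = e_K(S(t) − Φ(e,φ+θ+t))` (pp) resp.
`e_K(Φ(e,φ+θ+t) − D(t))` (ph).  This file records the exact facts that make its t-derivative (the anisotropy defect `𝒜`) vanish at the two singular configurations
of the bubble (memo §24.2):

* §1 pp: at the COOPER configuration `(ρ,ϑ) = (0,π)` the partner band is `≡ e` for every loop variable and every `t` (nesting: `S ≡ 0`, `e_K` even;
  `partnerBand_pp_cooper`); at the TANGENCY configuration `(ρ,ϑ) = (0,0)` (`S(t) = 2Φ(0,θ+t) ∈ 2·FS`) and the loop at the tangency point it is `≡ 0`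
  (`partnerBand_pp_tangency`), and it is CRITICAL there in both loop variables: `∂_φ|₀ ē = 0` (`deriv_partnerBand_pp_tangency_angle`, because `e_K ∘ Φ(0,·) ≡ 0`) and
  `∂_e|₀ (ē + e) = 0` (`deriv_partnerBand_pp_tangency_level`, because `e_K ∘ Φ(·,α) = id`);
* §2 ph: at the FORWARD configuration `(0,0)` the partner band is `≡ e` (`D ≡ 0`; `partnerBand_ph_forward`); at the ph TANGENCY configuration `(0,π)`
  (`D(t) = 2Φ(0,θ+t)`) it is `≡ 0` at the tangency point and critical in both loop variables (`partnerBand_ph_tangency`, `deriv_partnerBand_ph_tangency_angle/_level`).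

Exact calculus on the tree's chart (`frameLevel_levelPoint`, `levelPoint_add_pi`, `contDiffAt_levelPoint`, `contDiff_frameLevel`); nothing about sizes; nothing asserts
superconductivity.  References: FST II CPAM 51 (1998) §3 Thm 3.5; BGM 2006 §2.4 (2.40) [cite: BenfattoGiulianiMastropietro2006].
-/

noncomputable section

namespace Summit.HubbardSuperconductivity.HubbardSuperconductivity.Theorems.C4a

set_option linter.dupNamespace false -- summit = problem name (single-conjunct summit), D-0017

open Real Set Filter
open scoped Topology
open Literature.MathematicalPhysics.QuantumLattice Literature.MathematicalPhysics.QuantumLattice.BandSectorCounting Literature.Probability.LatticeModels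
open Summit.HubbardSuperconductivity.HubbardSuperconductivity.Theorems.KLRegimeSplit
open Summit.HubbardSuperconductivity.HubbardSuperconductivity.Theorems.DispersionFlow
open Summit.HubbardSuperconductivity.HubbardSuperconductivity.Theorems.PerturbedFermiCurve

section Band

variable {a b : ℝ} (B : BandBounds a b) {K : TrigPolyC4v} {A : ℝ}
  (hA : ∀ p : Momentum, ∀ j ≤ 2, ‖iteratedFDeriv ℝ j (frameShift K) p‖ ≤ A) (hADt : 2 * A < B.Dtmin)
  {μ r : ℝ} (hr : 0 < r) (hlo : a < μ - r - A) (hhi : μ + r + A < b)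
include B hA hADt hr hlo hhi

/-! ## §0 Chart calculus: the Fermi curve is a level set, the level coordinate is the band -/

omit hADt in
/-- `e_K(Φ(0, α)) = 0` for every angle: the zero-level chart curve is the Fermi curve. -/
theorem frameLevel_levelPoint_zero (α : ℝ) : frameLevel μ K (levelPoint μ K 0 α) = 0 :=
  frameLevel_levelPoint B hA (ρ := 0) (by linarith) (by linarith) α

omit hADt hr in
/-- `e_K(Φ(e, α)) = e` on the tube `|e| < r`. -/
theorem frameLevel_levelPoint_tube {e : ℝ} (he : |e| < r) (α : ℝ) : frameLevel μ K (levelPoint μ K e α) = e := by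
  have h := abs_lt.1 he
  exact frameLevel_levelPoint B hA (ρ := e) (by linarith) (by linarith) α

/-- The chart is differentiable in the angle at level `0`. -/
theorem differentiableAt_levelPoint_angle (α : ℝ) : DifferentiableAt ℝ (fun s : ℝ => levelPoint μ K 0 s) α := by
  have h0 : |(0 : ℝ)| < r := by simpa using hr
  exact ((contDiff_levelPoint_angle B hA hADt hlo hhi h0 (m := 1)).differentiable one_ne_zero) α

/-- The chart is differentiable in the level at level `0`. -/
theorem differentiableAt_levelPoint_level (α : ℝ) : DifferentiableAt ℝ (fun e : ℝ => levelPoint μ K e α) 0 := by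
  have hj : ContDiffAt ℝ 1 (fun p : ℝ × ℝ => levelPoint μ K p.1 p.2) ((0 : ℝ), α) :=
    contDiffAt_levelPoint B hA hADt (μ := μ) (ρ₀ := 0) (by linarith) (by linarith) (m := 1) α
  have hline : DifferentiableAt ℝ (fun e : ℝ => ((e, α) : ℝ × ℝ)) 0 := differentiableAt_id.prodMk (differentiableAt_const _)
  have hfun : (fun e : ℝ => levelPoint μ K e α) = (fun p : ℝ × ℝ => levelPoint μ K p.1 p.2) ∘ fun e : ℝ => ((e, α) : ℝ × ℝ) := rfl
  rw [hfun]
  exact (hj.differentiableAt one_ne_zero).comp 0 hline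

/-- **The tangential derivative of the band along the Fermi curve vanishes**: `De_K(Φ(0,α))[Φ′(0,α)] = 0`. -/
theorem fderiv_frameLevel_deriv_levelPoint_angle (α : ℝ) :
    fderiv ℝ (frameLevel μ K) (levelPoint μ K 0 α) (deriv (fun s : ℝ => levelPoint μ K 0 s) α) = 0 := by
  have hF : DifferentiableAt ℝ (frameLevel μ K) (levelPoint μ K 0 α) :=
    ((EngineV8.contDiff_frameLevel μ K (n := 1)).differentiable one_ne_zero) _
  have hcomp : HasDerivAt (fun s : ℝ => frameLevel μ K (levelPoint μ K 0 s))
      (fderiv ℝ (frameLevel μ K) (levelPoint μ K 0 α) (deriv (fun s : ℝ => levelPoint μ K 0 s) α)) α :=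
    hF.hasFDerivAt.comp_hasDerivAt α (differentiableAt_levelPoint_angle B hA hADt hr hlo hhi α).hasDerivAt
  have hconst : (fun s : ℝ => frameLevel μ K (levelPoint μ K 0 s)) = fun _ => (0 : ℝ) := funext (frameLevel_levelPoint_zero B hA hr hlo hhi)
  have h0 : HasDerivAt (fun s : ℝ => frameLevel μ K (levelPoint μ K 0 s)) 0 α := by rw [hconst]; exact hasDerivAt_const α 0
  exact hcomp.unique h0

/-- **The level derivative of the band across the chart is one**: `De_K(Φ(0,α))[∂_eΦ(0,α)] = 1`. -/
theorem fderiv_frameLevel_deriv_levelPoint_level (α : ℝ) :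
    fderiv ℝ (frameLevel μ K) (levelPoint μ K 0 α) (deriv (fun e : ℝ => levelPoint μ K e α) 0) = 1 := by
  have hF : DifferentiableAt ℝ (frameLevel μ K) (levelPoint μ K 0 α) :=
    ((EngineV8.contDiff_frameLevel μ K (n := 1)).differentiable one_ne_zero) _
  have hcomp := hF.hasFDerivAt.comp_hasDerivAt (0 : ℝ) (differentiableAt_levelPoint_level B hA hADt hr hlo hhi α).hasDerivAt
  -- on the tube the composite is the identity
  have hev : (fun e : ℝ => frameLevel μ K (levelPoint μ K e α)) =ᶠ[𝓝 0] fun e => e := by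
    have hopen : ∀ᶠ e : ℝ in 𝓝 0, |e| < r := by
      have : Ioo (-r) r ∈ 𝓝 (0 : ℝ) := Ioo_mem_nhds (by linarith) hr
      filter_upwards [this] with e he using abs_lt.2 he
    filter_upwards [hopen] with e he using frameLevel_levelPoint_tube B hA hlo hhi he α
  have h1 : HasDerivAt (fun e : ℝ => frameLevel μ K (levelPoint μ K e α)) 1 0 := (hasDerivAt_id (0 : ℝ)).congr_of_eventuallyEq hev
  exact hcomp.unique h1

/-! ## §1 The pp loop: partner band `e_K(S(t) − Φ(e, φ+θ+t))` along the pair-sum path -/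

omit hADt hr in
/-- **COOPER NESTING (exact)**: at `(ρ,ϑ) = (0,π)` the pair-sum path vanishes and the partner band of EVERY loop point is its own level:
`e_K(S(t) − Φ(e,φ+θ+t)) = e` for all `t` (`|e| < r`). -/
theorem partnerBand_pp_cooper {e : ℝ} (he : |e| < r) (θ φ t : ℝ) :
    frameLevel μ K (pairSumPath μ K 0 π θ t - levelPoint μ K e (φ + θ + t)) = e := by
  have h := abs_lt.1 he
  rw [pairSumPath_cooper, zero_sub]
  exact frameLevel_neg_levelPoint B hA (ρ := e) (by linarith) (by linarith) _

omit hADt in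
/-- **TANGENCY (value)**: at `(ρ,ϑ) = (0,0)` (`S(t) = Φ(0,θ+t) + Φ(0,θ+t) ∈ 2·FS`) the loop point AT the tangency point (`e = 0`, `φ = 0`) has partner band `0` for all `t`. -/
theorem partnerBand_pp_tangency (θ t : ℝ) : frameLevel μ K (pairSumPath μ K 0 0 θ t - levelPoint μ K 0 (0 + θ + t)) = 0 := by
  simp only [pairSumPath, zero_add, add_sub_cancel_right]
  exact frameLevel_levelPoint_zero B hA hr hlo hhi _

/-- **TANGENCY is critical in the loop ANGLE**: `∂_φ|_{φ=0} e_K(S(t) − Φ(0, φ+θ+t)) = 0` at `(ρ,ϑ) = (0,0)` — the band is constant along the Fermi curve. -/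
theorem deriv_partnerBand_pp_tangency_angle (θ t : ℝ) :
    deriv (fun φ : ℝ => frameLevel μ K (pairSumPath μ K 0 0 θ t - levelPoint μ K 0 (φ + θ + t))) 0 = 0 := by
  have hS : pairSumPath μ K 0 0 θ t = levelPoint μ K 0 (θ + t) + levelPoint μ K 0 (θ + t) := by rw [pairSumPath, zero_add]
  have hF : DifferentiableAt ℝ (frameLevel μ K) (pairSumPath μ K 0 0 θ t - levelPoint μ K 0 (0 + θ + t)) :=
    ((EngineV8.contDiff_frameLevel μ K (n := 1)).differentiable one_ne_zero) _
  -- the inner path `φ ↦ S − Φ(0, φ+θ+t)`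
  have hin : HasDerivAt (fun φ : ℝ => pairSumPath μ K 0 0 θ t - levelPoint μ K 0 (φ + θ + t))
      (-(deriv (fun s : ℝ => levelPoint μ K 0 s) (θ + t))) 0 := by
    have hγ : HasDerivAt (fun φ : ℝ => levelPoint μ K 0 (φ + (θ + t))) (deriv (fun s : ℝ => levelPoint μ K 0 s) (0 + (θ + t))) 0 :=
      HasDerivAt.comp_add_const 0 (θ + t) (differentiableAt_levelPoint_angle B hA hADt hr hlo hhi _).hasDerivAt
    rw [zero_add] at hγ
    have h := (hasDerivAt_const (0 : ℝ) (pairSumPath μ K 0 0 θ t)).sub hγ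
    simp only [zero_sub, add_assoc] at h ⊢
    exact h
  have hcomp := hF.hasFDerivAt.comp_hasDerivAt (0 : ℝ) hin
  have hpt : pairSumPath μ K 0 0 θ t - levelPoint μ K 0 (0 + θ + t) = levelPoint μ K 0 (θ + t) := by rw [zero_add, hS, add_sub_cancel_right]
  rw [hpt, map_neg, fderiv_frameLevel_deriv_levelPoint_angle B hA hADt hr hlo hhi, neg_zero] at hcomp
  exact hcomp.deriv

/-- **TANGENCY is critical in the loop LEVEL**: `∂_e|_{e=0} [e_K(S(t) − Φ(e, θ+t)) + e] = 0` at `(ρ,ϑ) = (0,0)` — to first order the partner band is `−e`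
(with a θ-INDEPENDENT coefficient). -/
theorem deriv_partnerBand_pp_tangency_level (θ t : ℝ) :
    deriv (fun e : ℝ => frameLevel μ K (pairSumPath μ K 0 0 θ t - levelPoint μ K e (θ + t)) + e) 0 = 0 := by
  have hS : pairSumPath μ K 0 0 θ t = levelPoint μ K 0 (θ + t) + levelPoint μ K 0 (θ + t) := by rw [pairSumPath, zero_add]
  have hF : DifferentiableAt ℝ (frameLevel μ K) (pairSumPath μ K 0 0 θ t - levelPoint μ K 0 (θ + t)) :=
    ((EngineV8.contDiff_frameLevel μ K (n := 1)).differentiable one_ne_zero) _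
  have hin : HasDerivAt (fun e : ℝ => pairSumPath μ K 0 0 θ t - levelPoint μ K e (θ + t)) (-(deriv (fun e : ℝ => levelPoint μ K e (θ + t)) 0)) 0 := by
    have h := (hasDerivAt_const (0 : ℝ) (pairSumPath μ K 0 0 θ t)).sub (differentiableAt_levelPoint_level B hA hADt hr hlo hhi (θ + t)).hasDerivAt
    rwa [zero_sub] at h
  have hcomp := (hF.hasFDerivAt.comp_hasDerivAt (0 : ℝ) hin).add (hasDerivAt_id (0 : ℝ))
  have hpt : pairSumPath μ K 0 0 θ t - levelPoint μ K 0 (θ + t) = levelPoint μ K 0 (θ + t) := by rw [hS, add_sub_cancel_right]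
  rw [hpt, map_neg, fderiv_frameLevel_deriv_levelPoint_level B hA hADt hr hlo hhi, neg_add_cancel] at hcomp
  exact hcomp.deriv

/-! ## §2 The ph loop: partner band `e_K(Φ(e, φ+θ+t) − D(t))` along the pair-difference path -/

omit hADt hr in
/-- **FORWARD NESTING (exact)**: at `(ρ,ϑ) = (0,0)` the pair-difference path vanishes and `e_K(Φ(e,φ+θ+t) − D(t)) = e` for all `t` (`|e| < r`). -/
theorem partnerBand_ph_forward {e : ℝ} (he : |e| < r) (θ φ t : ℝ) :
    frameLevel μ K (levelPoint μ K e (φ + θ + t) - pairDiffPath μ K 0 0 θ t) = e := by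
  rw [pairDiffPath_forward, sub_zero]
  exact frameLevel_levelPoint_tube B hA hlo hhi he _

omit B hA hADt hr hlo hhi in
/-- The ph tangency configuration: `D(t) = Φ(0,θ+t) − Φ(0,π+θ+t) = Φ(0,θ+t) + Φ(0,θ+t) ∈ 2·FS`. -/
theorem pairDiffPath_tangency (μ : ℝ) (K : TrigPolyC4v) (θ t : ℝ) : pairDiffPath μ K 0 π θ t = levelPoint μ K 0 (θ + t) + levelPoint μ K 0 (θ + t) := by
  rw [pairDiffPath, show π + θ + t = (θ + t) + π by ring, levelPoint_add_pi, sub_neg_eq_add]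

omit hADt in
/-- **ph TANGENCY (value)**: at `(ρ,ϑ) = (0,π)` the loop point at the tangency point (`e = 0`, `φ = 0`) has partner band `0` for all `t` (`e_K` even). -/
theorem partnerBand_ph_tangency (θ t : ℝ) : frameLevel μ K (levelPoint μ K 0 (0 + θ + t) - pairDiffPath μ K 0 π θ t) = 0 := by
  rw [pairDiffPath_tangency μ K, zero_add, show levelPoint μ K 0 (θ + t) - (levelPoint μ K 0 (θ + t) + levelPoint μ K 0 (θ + t)) =
    -levelPoint μ K 0 (θ + t) by abel, frameLevel_neg]
  exact frameLevel_levelPoint_zero B hA hr hlo hhi _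

/-- **ph TANGENCY is critical in the loop ANGLE**: `∂_φ|_{φ=0} e_K(Φ(0, φ+θ+t) − D(t)) = 0` at `(ρ,ϑ) = (0,π)`. -/
theorem deriv_partnerBand_ph_tangency_angle (θ t : ℝ) :
    deriv (fun φ : ℝ => frameLevel μ K (levelPoint μ K 0 (φ + θ + t) - pairDiffPath μ K 0 π θ t)) 0 = 0 := by
  -- reflect: `e_K(Φ − D) = e_K(D − Φ)` and `D − Φ(0,φ+θ+t)` at `φ = 0` is `Φ(0,θ+t)`
  have hfun : (fun φ : ℝ => frameLevel μ K (levelPoint μ K 0 (φ + θ + t) - pairDiffPath μ K 0 π θ t)) =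
      fun φ : ℝ => frameLevel μ K (pairDiffPath μ K 0 π θ t - levelPoint μ K 0 (φ + θ + t)) := by
    funext φ; rw [← frameLevel_neg, neg_sub]
  rw [hfun]
  have hD := pairDiffPath_tangency μ K θ t
  have hF : DifferentiableAt ℝ (frameLevel μ K) (pairDiffPath μ K 0 π θ t - levelPoint μ K 0 (0 + θ + t)) :=
    ((EngineV8.contDiff_frameLevel μ K (n := 1)).differentiable one_ne_zero) _
  have hin : HasDerivAt (fun φ : ℝ => pairDiffPath μ K 0 π θ t - levelPoint μ K 0 (φ + θ + t))
      (-(deriv (fun s : ℝ => levelPoint μ K 0 s) (θ + t))) 0 := by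
    have hγ : HasDerivAt (fun φ : ℝ => levelPoint μ K 0 (φ + (θ + t))) (deriv (fun s : ℝ => levelPoint μ K 0 s) (0 + (θ + t))) 0 :=
      HasDerivAt.comp_add_const 0 (θ + t) (differentiableAt_levelPoint_angle B hA hADt hr hlo hhi _).hasDerivAt
    rw [zero_add] at hγ
    have h := (hasDerivAt_const (0 : ℝ) (pairDiffPath μ K 0 π θ t)).sub hγ
    simp only [zero_sub, add_assoc] at h ⊢
    exact h
  have hcomp := hF.hasFDerivAt.comp_hasDerivAt (0 : ℝ) hin
  have hpt : pairDiffPath μ K 0 π θ t - levelPoint μ K 0 (0 + θ + t) = levelPoint μ K 0 (θ + t) := by rw [zero_add, hD, add_sub_cancel_right]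
  rw [hpt, map_neg, fderiv_frameLevel_deriv_levelPoint_angle B hA hADt hr hlo hhi, neg_zero] at hcomp
  exact hcomp.deriv

/-- **ph TANGENCY is critical in the loop LEVEL**: `∂_e|_{e=0} [e_K(Φ(e, θ+t) − D(t)) + e] = 0` at `(ρ,ϑ) = (0,π)`. -/
theorem deriv_partnerBand_ph_tangency_level (θ t : ℝ) :
    deriv (fun e : ℝ => frameLevel μ K (levelPoint μ K e (θ + t) - pairDiffPath μ K 0 π θ t) + e) 0 = 0 := by
  have hfun : (fun e : ℝ => frameLevel μ K (levelPoint μ K e (θ + t) - pairDiffPath μ K 0 π θ t) + e) =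
      fun e : ℝ => frameLevel μ K (pairDiffPath μ K 0 π θ t - levelPoint μ K e (θ + t)) + e := by
    funext e; rw [← frameLevel_neg, neg_sub]
  rw [hfun]
  have hD := pairDiffPath_tangency μ K θ t
  have hF : DifferentiableAt ℝ (frameLevel μ K) (pairDiffPath μ K 0 π θ t - levelPoint μ K 0 (θ + t)) :=
    ((EngineV8.contDiff_frameLevel μ K (n := 1)).differentiable one_ne_zero) _
  have hin : HasDerivAt (fun e : ℝ => pairDiffPath μ K 0 π θ t - levelPoint μ K e (θ + t)) (-(deriv (fun e : ℝ => levelPoint μ K e (θ + t)) 0)) 0 := by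
    have h := (hasDerivAt_const (0 : ℝ) (pairDiffPath μ K 0 π θ t)).sub (differentiableAt_levelPoint_level B hA hADt hr hlo hhi (θ + t)).hasDerivAt
    rwa [zero_sub] at h
  have hcomp := (hF.hasFDerivAt.comp_hasDerivAt (0 : ℝ) hin).add (hasDerivAt_id (0 : ℝ))
  have hpt : pairDiffPath μ K 0 π θ t - levelPoint μ K 0 (θ + t) = levelPoint μ K 0 (θ + t) := by rw [hD, add_sub_cancel_right]
  rw [hpt, map_neg, fderiv_frameLevel_deriv_levelPoint_level B hA hADt hr hlo hhi, neg_add_cancel] at hcomp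
  exact hcomp.deriv

end Band

end Summit.HubbardSuperconductivity.HubbardSuperconductivity.Theorems.C4a

end
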